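import Literature.AlgebraicGeometry.Motives.AbelianVarietyQuotientMap
import HarnessLib

/-!
# `Γ(U, 𝒪_{P/S}) ↠ Γ(q⁻¹U, 𝒪_P)^S`: invariant functions on `P` descend to the quotient `P/S`

Layer `Literature/AlgebraicGeometry/Motives`, namespace `Literature.AlgebraicGeometry.Motives.AbelianVariety`.
(Typing debt of cell `pub-hodge-ring2`, R13.62 (2), towards `IsogenyPullbackPushforwardDecomposition_holds`: research route
conditional on HC_CM; not a corollary; Q11.4-sentence-2 already refuted in dim ≥ 3.)

The tree's quotient `P/S` of an abelian variety `P` over `K` by a finite subgroup `S ⊆ P(L)` (`L/K` finite Galois) is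
`Spec_P((r_* 𝒪_Y)^G)` for `Y = P_L`, `G = S ⋊ Aut(L/K)`, `r = pr ≫ q : Y → P` (`AbelianVariety.quotAction`,
`AbelianVarietyQuotientMap`), with quotient map `h : P → P/S` the lift of `q` along the descent homomorphisms
`φ_U : Γ(Y, r⁻¹U)^G → Γ(P, q⁻¹U)`. This file records, for **rational** subgroups `S ⊆ P(K)` (`L = K`, the case of the
complex quotients `AbelianVariety.torsionQuot`), the half of Mumford's description of the quotient (§7 Theorem p. 66 (2):
`Γ(U, 𝒪_{X/G}) = Γ(π⁻¹U, 𝒪_X)^G`; §7 Thm. 4) that the decomposition `h^*h_*F ≅ ⊕ t_s^*F` needs: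

* `transl_fst_self` — for `L = K` the translation `transl s` of `Y = P_K` lies over the translation `t_s` of `P`:
  `transl s ≫ pr = pr ≫ t_s` (`transl_fst` with `constPt s = fstPt ≫ (Spec K → P)`, `constPt_eq_fstPt_comp`).
* `act_prApp_eq_of_forall_translation` — a section `c ∈ Γ(P, q⁻¹U)` fixed by all `t_s♯`, `s ∈ S`, pulls back to a
  `G`-invariant section `pr♯ c ∈ Γ(Y, r⁻¹U)^G` (the Galois part acts trivially on `pr♯ c`, the `S`-part through `t_s♯`).
* `exists_quotientMap_appLE_eq` — **`Γ(h⁻¹'U', 𝒪_{P/S}) ↠ Γ(q⁻¹U, 𝒪_P)^S`** over the affine charts `U' = (P/S → P)⁻¹U`,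
  `U ⊆ P` affine: every `S`-invariant `c ∈ Γ(P, q⁻¹U)` is `h♯ r` for the section `r ↔ pr♯ c` of
  `Γ(P/S, U') ≅ Γ(Y, r⁻¹U)^G` (`SubringDatum.objIso`, `SubringDatum.lift_app_preimage`, `descentHom_eq`).

## References

* [MumfordAV1970] D. Mumford, *Abelian Varieties* (1970), §7 Theorem p. 66 (2) and Thm. 4 (p. 72); §12 Thm. 1 (p. 111).
* [GortzWedhorn2023] U. Görtz, T. Wedhorn, *Algebraic Geometry II* (2023), Def./Rem. 27.1 (p. 799), Thm. 27.68.
-/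

noncomputable section

universe u

open CategoryTheory CategoryTheory.Limits AlgebraicGeometry TopologicalSpace Opposite

namespace Literature.AlgebraicGeometry.Motives

namespace AbelianVariety

open scoped MonObj Obj
open Literature.AlgebraicGeometry.RelativeSpec

variable {K : Type u} [Field K] (P : AbelianVariety K)

/-! ### `L = K`: the translations of `Y = P_K` lie over the translations of `P` -/

/-- `Spec K → Spec K` (the base change datum for `L = K`) is the identity. [folklore] -/
private theorem bcSpec_self : bcSpec K K = 𝟙 (Spec (.of K)) := by
  change Spec.map (CommRingCat.ofHom (algebraMap K K)) = _
  rw [Algebra.algebraMap_self, CommRingCat.ofHom_id, Spec.map_id]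

/-- For `L = K` the constant point at `s ∈ P(K)` is `pr` followed by the structure morphism and `s`:
`constPt s = fstPt ≫ (P → Spec K) ≫ s`. [cite: GortzWedhorn2023, Def./Rem. 27.1 (p. 799)] -/
theorem constPt_eq_fstPt_comp (s : P.Points K) : P.constPt K s = P.fstPt K ≫ toSpecOver P.X ≫ s := by
  apply Over.OverMorphism.ext
  have h := pullback.condition (f := P.X.hom) (g := bcSpec K K)
  have h2 : bcSpec K K ≫ s.left = s.left := by
    rw [bcSpec_self]
    exact Category.id_comp _
  rw [constPt_left, Over.comp_left, Over.comp_left, fstPt_left, toSpecOver_left]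
  have h3 : (pullback.fst P.X.hom (bcSpec K K) ≫ P.X.hom) ≫ s.left = pullback.snd P.X.hom (bcSpec K K) ≫ s.left :=
    (congrArg (· ≫ s.left) h).trans ((Category.assoc _ _ _).trans (congrArg (pullback.snd P.X.hom (bcSpec K K) ≫ ·) h2))
  exact h3.symm.trans (Category.assoc _ _ _)

/-- **For `L = K`, `transl s ≫ pr = pr ≫ t_s`**: the translation of `Y = P ×_K Spec K` by `s ∈ P(K)` lies over the
translation `t_s` of `P` (`transl_fst`: on `Y`-points `transl s` is left multiplication by the constant point, which
for a rational point factors through `pr`). [cite: GortzWedhorn2023, Def./Rem. 27.1 (p. 799)] -/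
theorem transl_fst_self (s : P.Points K) :
    P.transl K s ≫ pullback.fst P.X.hom (bcSpec K K) =
      pullback.fst P.X.hom (bcSpec K K) ≫ (P.translation s).left := by
  rw [transl_fst, constPt_eq_fstPt_comp, ← comp_translation_eq]
  rfl

/-! ### `S`-invariant sections of `P` pull back to `G`-invariant sections of `Y` -/

variable (S : Subgroup (P.Points K)) (hS : ∀ (σ : K ≃ₐ[K] K) (s : P.Points K), s ∈ S → σ • s ∈ S)
  (q : P ⟶ P) (hSq : ∀ s ∈ S, s ≫ q.hom.hom.hom = 1)

/-- Translations by points killed by `q` do not change `q`: `t_s ≫ q = q` (the tree's `translation_comp_eq_self`, on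
underlying schemes). [cite: MumfordAV1970, §7 Thm. 4 (p. 72)] -/
theorem translation_left_comp_toSchemeHom_eq (s : P.Points K) (hs : s ≫ q.hom.hom.hom = 1) :
    (P.translation s).left ≫ Hom.toSchemeHom q = Hom.toSchemeHom q := by
  have h : P.translation s ≫ q.hom.hom.hom = q.hom.hom.hom := by
    unfold translation
    rw [MonObj.mul_comp, Category.assoc, hs, MonObj.comp_one, one_mul, Category.id_comp]
  exact congrArg CommaMorphism.left h

include hSq in
/-- `q⁻¹U ⊆ t_s⁻¹(q⁻¹U)` for `s ∈ S` (as `t_s ≫ q = q`). [cite: MumfordAV1970, §7 Thm. 4 (p. 72)] -/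
theorem preimage_le_translation_preimage (U : P.X.left.Opens) (s : S) :
    Hom.toSchemeHom q ⁻¹ᵁ U ≤ (P.translation s.1).left ⁻¹ᵁ (Hom.toSchemeHom q ⁻¹ᵁ U) := by
  rw [← Scheme.Hom.comp_preimage, P.translation_left_comp_toSchemeHom_eq q s.1 (hSq s.1 s.2)]

/-- `appLE` only depends on the morphism (transport along an equality of morphisms). [folklore] -/
private theorem appLE_congr_hom' {X Y : Scheme.{u}} {f g : X ⟶ Y} (h : f = g) (U : Y.Opens) (V : X.Opens)
    (e : V ≤ f ⁻¹ᵁ U) (e' : V ≤ g ⁻¹ᵁ U) : f.appLE U V e = g.appLE U V e' := by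
  subst h
  rfl

/-- **An `S`-invariant section of `P` over `q⁻¹U` pulls back to a `G`-invariant section of `Y` over `r⁻¹U`**
(`G = S ⋊ Aut(K/K)`): the element `g⁻¹ = (s', σ')` acts on `pr♯ c` through `gal σ' ≫ transl s' ≫ pr = pr ≫ t_{s'}`
(`gal_fst`, `transl_fst_self`), i.e. by `pr♯ (t_{s'}♯ c) = pr♯ c`. [cite: MumfordAV1970, §7 Theorem p. 66 (2) and Thm. 4 (p. 72)] -/
theorem act_prApp_eq_of_forall_translation (U : P.X.left.Opens) (c : Γ(P.X.left, Hom.toSchemeHom q ⁻¹ᵁ U))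
    (hc : ∀ s : S, (P.translation s.1).left.appLE (Hom.toSchemeHom q ⁻¹ᵁ U) (Hom.toSchemeHom q ⁻¹ᵁ U)
      (P.preimage_le_translation_preimage S q hSq U s) c = c)
    (g : S ⋊[P.galMulAut K S hS] (K ≃ₐ[K] K)) :
    (P.quotAction K S hS q hSq).act g U (P.prApp K q U c) = P.prApp K q U c := by
  have hfst : ((P.quotAction K S hS q hSq).aut g⁻¹).hom ≫ pullback.fst P.X.hom (bcSpec K K) =
      pullback.fst P.X.hom (bcSpec K K) ≫ (P.translation ((g⁻¹).left : S).1).left := by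
    rw [quotAction_aut_hom, Category.assoc, transl_fst_self, ← Category.assoc, gal_fst]
  have hsplit := Scheme.Hom.appLE_comp_appLE (pullback.fst P.X.hom (bcSpec K K))
    (P.translation ((g⁻¹).left : S).1).left (Hom.toSchemeHom q ⁻¹ᵁ U) (Hom.toSchemeHom q ⁻¹ᵁ U) (P.quotR K q ⁻¹ᵁ U)
    (P.preimage_le_translation_preimage S q hSq U (g⁻¹).left) le_rfl
  rw [ActionOver.act_apply, ← CommRingCat.comp_apply, Scheme.Hom.appLE_comp_appLE,
    appLE_congr_hom' hfst _ _ _ ((pullback.fst P.X.hom (bcSpec K K)).preimage_mono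
      (P.preimage_le_translation_preimage S q hSq U (g⁻¹).left)), ← hsplit, CommRingCat.comp_apply, hc]

/-! ### Invariant sections descend to the quotient -/

variable [Finite S] [IsAffineHom (Hom.toSchemeHom q)]

/-- `h⁻¹((P/S → P)⁻¹ U) = q⁻¹U` (`h ≫ (P/S → P) = q`). [cite: MumfordAV1970, §7 Thm. 4 (p. 72)] -/
theorem quotientMap_preimage_quotientToBase_preimage (U : P.X.left.Opens) :
    P.quotientMap K S hS q hSq ⁻¹ᵁ ((P.quotAction K S hS q hSq).quotientToBase ⁻¹ᵁ U) = Hom.toSchemeHom q ⁻¹ᵁ U := by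
  rw [← Scheme.Hom.comp_preimage, quotientMap_quotientToBase]

/-- **`Γ(U', 𝒪_{P/S}) ↠ Γ(q⁻¹U, 𝒪_P)^S` on the affine charts `U' = (P/S → P)⁻¹U`** (`U ⊆ P` affine open, `S ⊆ P(K)`
rational): every section `c` of `P` over `q⁻¹U = h⁻¹U'` fixed by the translations `t_s♯`, `s ∈ S`, is `h♯ r` for a
(unique) section `r` of `P/S` over `U'` — namely `r ↔ pr♯ c` under `Γ(P/S, U') ≅ Γ(Y, r⁻¹U)^G` (Mumford §7, Theorem p. 66
(2): `Γ(U, 𝒪_{X/G}) = Γ(π⁻¹U, 𝒪_X)^G`, and Thm. 4). [cite: MumfordAV1970, §7 Theorem p. 66 (2) and Thm. 4 (p. 72)] -/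
theorem exists_quotientMap_appLE_eq (U : P.X.left.affineOpens) (c : Γ(P.X.left, Hom.toSchemeHom q ⁻¹ᵁ U))
    (hc : ∀ s : S, (P.translation s.1).left.appLE (Hom.toSchemeHom q ⁻¹ᵁ U) (Hom.toSchemeHom q ⁻¹ᵁ U)
      (P.preimage_le_translation_preimage S q hSq U s) c = c) :
    ∃ r : Γ((P.quotAction K S hS q hSq).quotient, (P.quotAction K S hS q hSq).quotientToBase ⁻¹ᵁ U),
      (P.quotientMap K S hS q hSq).appLE ((P.quotAction K S hS q hSq).quotientToBase ⁻¹ᵁ U) (Hom.toSchemeHom q ⁻¹ᵁ U)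
        (P.quotientMap_preimage_quotientToBase_preimage S hS q hSq U).ge r = c := by
  -- the `G`-invariant section `pr♯ c`
  have hmem : P.prApp K q U c ∈ (P.quotAction K S hS q hSq).invariants.ring U := fun g =>
    P.act_prApp_eq_of_forall_translation S hS q hSq U c hc g
  let d : (P.quotAction K S hS q hSq).invariants.ring U := ⟨P.prApp K q U c, hmem⟩
  refine ⟨((P.quotAction K S hS q hSq).invariants.objIso U.2).inv d, ?_⟩
  -- `h♯` on the chart is `objIso ≫ φ_U ≫ (transport along h⁻¹U' = q⁻¹U)`
  have happ : (P.quotientMap K S hS q hSq).app ((P.quotAction K S hS q hSq).quotientToBase ⁻¹ᵁ U) =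
      ((P.quotAction K S hS q hSq).invariants.objIso U.2).hom ≫ (P.descentTrans K S hS q hSq).app (op U.1) ≫
        P.X.left.presheaf.map (eqToHom (P.quotientMap_preimage_quotientToBase_preimage S hS q hSq U)).op :=
    (P.quotAction K S hS q hSq).invariants.lift_app_preimage (Hom.toSchemeHom q) (P.descentTrans K S hS q hSq)
      (P.diagramMap_descentTrans K S hS q hSq) U
  have hφ : P.descentHom K S hS q hSq U d = c := P.descentHom_eq K S hS q hSq U rfl
  rw [Scheme.Hom.appLE, CommRingCat.comp_apply, happ, CommRingCat.comp_apply, CommRingCat.comp_apply,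
    Iso.inv_hom_id_apply]
  change (P.X.left.presheaf.map (homOfLE _).op) ((P.X.left.presheaf.map (eqToHom _).op)
    (P.descentHom K S hS q hSq U d)) = c
  rw [hφ, ← CommRingCat.comp_apply, presheaf_map_eqToHom_op_comp_map_homOfLE_op]
  rfl

end AbelianVariety

end Literature.AlgebraicGeometry.Motives

end
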